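import Summits.CriticalPhenomena.PercolationContinuityZ3.Theorems.FK.IsingMagnetizationCLT
import Summits.CriticalPhenomena.PercolationContinuityZ3.Theorems.FK.NewmanCLTDominated
import HarnessLib

/-!
# NEWMAN'S CLT FOR EVERY LOCAL OBSERVABLE OF THE ISING MODEL (energy density, pattern frequencies, any `f` of finitely
# many spins): `|Λ_n|^{-1/2} Σ_{z∈Λ_n} (f∘θ_z − E f) ⇒ N(0, Σ_z Cov(f, f∘θ_z))` — GENERIC, AND IN THE FREE STATE BELOW `β_c`

Claimed R42 (8)(c) in the cell INBOX at 2026-08-28T18:14:08Z by fkp-10a gen 355 (NEW CLAIM #2 of the gen), addressed to coordinator fk-4 (next seated gen; (ι) in force for windows); lineage row FO-10a-g355l (self-suggested), package g355-isinglocal, label IM-D.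
Helper file of the `fk-continuity` build cell (bschramm lane; `--supports stmt-CriticalPhenomena-4575`); builds on
p205010 (kernel theorem, internal audit signed; external expert review pending). No definitions, no sorries; standard
axioms.

Newman 1980, remark after (12) (and Newman 1983): Theorems 1–2 extend from increasing functions to functions DOMINATED
by increasing ones. A local spin observable `f` (depending on the spins in a finite window `D`, `|f| ≤ B`) is dominated
by the increasing local field `B Σ_{x∈D} σ_x`: for `σ ≤ σ'`, `|f(σ') − f(σ)| ≤ B Σ_{x∈D} (σ'_x − σ_x)`
(`abs_sub_le_of_dependsOn`) — if `σ, σ'` differ on `D` at all, some spin flips from `−1` to `+1` and contributes `2B`.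
Hence the tree's generic DOMINATED Newman CLT (`NewmanCLT.tendstoInDistribution_boxSum_of_dominated`, gen 354 GD-C)
applies to the translates `X_z = f ∘ θ_{−z}` under any positively associated translation-invariant spin measure with
summable truncated two-point function, the covariances of `f` being summable by Lipschitz domination
(`abs_covariance_le_covariance_of_dominated`, Newman's (12)).

* `covariance_comp_configShift_eq` — (B) for arbitrary observables: `Cov(g∘θ_{−x}, h∘θ_{−y}) = Cov(g, h∘θ_{−(y−x)})`.
* `abs_sub_le_of_dependsOn` — the domination of a local observable by `B Σ_{x∈D} σ_x`.
* `summable_cov_sum_spinAt_shift`, `summable_cov_localObservable_shift` — `z ↦ Cov(f, f∘θ_{−z})` is summable whenever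
  `z ↦ Cov(σ_0, σ_z)` is; `tsum_cov_localObservable_shift_nonneg` — its sum (the CLT variance) is `≥ 0`.
* **`tendstoInDistribution_localObservable_of_summable`** — GENERIC: positively associated + translation invariant +
  `Σ_z Cov(σ_0,σ_z) < ∞` ⇒ for every local `f`: `|Λ_n|^{-1/2} Σ_{z∈Λ_n}(f∘θ_{−z} − E f) ⇒ N(0, Σ_z Cov(f, f∘θ_{−z}))`.
* **`tendstoInDistribution_localObservable_free_of_lt_criticalBeta`** — the free state, `d ≥ 2`, `0 ≤ β < β_c(d)`
  (UNCONDITIONAL, sharpness).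

The plus phase (`β ≥ ltBeta d` unconditionally; all `β > β_c`, `d ≥ 3`, given Duminil-Copin–Goswami–Raoufi 2020) and the
energy density `Σ_i σ_0σ_{e_i}` (`D = {0, e_1, …, e_d}`) are in the companion file `IsingEnergyCLT`.

## References

* C. M. Newman, Comm. Math. Phys. 74 (1980) 119–128, Thm. 2 and the remark after (12); C. M. Newman, *A general central
  limit theorem for FKG systems*, Comm. Math. Phys. 91 (1983) 75–80. [Newman1980]
* R. S. Ellis, *Entropy, Large Deviations, and Statistical Mechanics*, Springer 2006, §V.7. [Ellis2006]
* S. Friedli, Y. Velenik, *Statistical Mechanics of Lattice Systems*, CUP 2017, Thm. 3.17, Lemma 3.19. [FriedliVelenik2017]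
-/

noncomputable section

namespace Summit.CriticalPhenomena.PercolationContinuityZ3.Theorems.FK

namespace IsingCLT

open MeasureTheory ProbabilityTheory Filter Topology Finset
open Literature.Probability.Percolation Literature.Probability.LatticeModels
open Summit.CriticalPhenomena.PercolationContinuityZ3.Theorems.FK.NewmanCLT

variable {d : ℕ}

/-! ### Translations of configurations and (B) for arbitrary observables -/

/-- `θ_v ∘ θ_w = θ_{v+w}` for the configuration shifts `(θ_v σ)_x = σ_{x−v}`. [folklore] -/
theorem configShift_configShift (v w : Site d) (σ : SpinConfig (Site d)) :
    configShift v (configShift w σ) = configShift (v + w) σ := by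
  funext x
  simp only [configShift_apply, sub_sub]

/-- `θ_0 = id`. [folklore] -/
theorem configShift_zero (σ : SpinConfig (Site d)) : configShift (0 : Site d) σ = σ := by
  funext x
  simp only [configShift_apply, sub_zero]

/-- **(B) for arbitrary observables**: for a translation-invariant measure and measurable `g, h`,
`Cov(g∘θ_{−x}, h∘θ_{−y}) = Cov(g, h∘θ_{−(y−x)})`. [cite: Newman1980, Thm. 2 (B); FriedliVelenik2017, Thm. 3.17 (2)] -/
theorem covariance_comp_configShift_eq {μ : Measure (SpinConfig (Site d))} (hμ : IsTranslationInvariantMeasure μ)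
    (g h : SpinConfig (Site d) → ℝ) (x y : Site d) :
    cov[fun σ => g (configShift (-x) σ), fun σ => h (configShift (-y) σ); μ] =
      cov[g, fun σ => h (configShift (-(y - x)) σ); μ] := by
  conv_lhs => rw [← hμ x]
  rw [covariance_map_equiv]
  have h1 : (fun σ => g (configShift (-x) σ)) ∘ (configShift (S := ℤˣ) x) = g := by
    funext σ; rw [Function.comp_apply, configShift_configShift, neg_add_cancel, configShift_zero]
  have h2 : (fun σ => h (configShift (-y) σ)) ∘ (configShift (S := ℤˣ) x) =
      fun σ => h (configShift (-(y - x)) σ) := by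
    funext σ; rw [Function.comp_apply, configShift_configShift, neg_sub, sub_eq_neg_add]
  rw [h1, h2]

/-- The translated spin: `σ_x(θ_{−z} σ) = σ_{x+z}`. [folklore] -/
theorem spinAt_configShift_neg (z x : Site d) (σ : SpinConfig (Site d)) :
    spinAt x (configShift (-z) σ) = spinAt (x + z) σ := by
  rw [spinAt_configShift, sub_neg_eq_add]

/-! ### Domination of a local observable by the local magnetisation -/

/-- Two spins with `u ≤ u'` and `u ≠ u'` are `−1 < +1`: the real difference is `2`. [folklore] -/
theorem spinAt_sub_spinAt_eq_two {x : Site d} {σ σ' : SpinConfig (Site d)} (hle : σ x ≤ σ' x) (hne : σ x ≠ σ' x) :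
    spinAt x σ' - spinAt x σ = 2 := by
  rcases Int.units_eq_one_or (σ x) with h1 | h1 <;> rcases Int.units_eq_one_or (σ' x) with h2 | h2
  · exact absurd (h1.trans h2.symm) hne
  · rw [h1, h2] at hle; exact absurd hle (by decide)
  · simp [spinAt, h1, h2]; norm_num
  · exact absurd (h1.trans h2.symm) hne

/-- **A local observable is dominated by the local magnetisation** (Newman 1980, remark after (12), for spin systems):
if `f` depends only on the spins in the finite window `D` and `|f| ≤ B`, then for `σ ≤ σ'`,
`|f(σ') − f(σ)| ≤ B Σ_{x∈D} σ'_x − B Σ_{x∈D} σ_x`. [cite: Newman1980, remark after (12)] -/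
theorem abs_sub_le_of_dependsOn {f : SpinConfig (Site d) → ℝ} {D : Finset (Site d)} (hf : DependsOn f (↑D : Set (Site d)))
    {B : ℝ} (hB : ∀ σ, |f σ| ≤ B) ⦃σ σ' : SpinConfig (Site d)⦄ (hle : σ ≤ σ') :
    |f σ' - f σ| ≤ B * ∑ x ∈ D, spinAt x σ' - B * ∑ x ∈ D, spinAt x σ := by
  have hB0 : 0 ≤ B := (abs_nonneg _).trans (hB σ)
  have hterm : ∀ x ∈ D, 0 ≤ spinAt x σ' - spinAt x σ := fun x _ => sub_nonneg.2 (spinAt_mono x hle)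
  rw [← mul_sub, ← Finset.sum_sub_distrib]
  by_cases hD : ∀ x ∈ (↑D : Set (Site d)), σ x = σ' x
  · rw [hf hD, sub_self, abs_zero]
    exact mul_nonneg hB0 (Finset.sum_nonneg hterm)
  · push Not at hD
    obtain ⟨x₀, hx₀, hne⟩ := hD
    have h2 : (2 : ℝ) ≤ ∑ x ∈ D, (spinAt x σ' - spinAt x σ) := by
      rw [← spinAt_sub_spinAt_eq_two (hle x₀) hne]
      exact Finset.single_le_sum hterm (Finset.mem_coe.1 hx₀)
    calc |f σ' - f σ| ≤ |f σ'| + |f σ| := abs_sub _ _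
      _ ≤ B + B := add_le_add (hB σ') (hB σ)
      _ = B * 2 := by ring
      _ ≤ B * ∑ x ∈ D, (spinAt x σ' - spinAt x σ) := mul_le_mul_of_nonneg_left h2 hB0

/-- The local magnetisation `B Σ_{x∈D} σ_x` is measurable. [folklore] -/
theorem measurable_mul_sum_spinAt (B : ℝ) (D : Finset (Site d)) :
    Measurable fun σ : SpinConfig (Site d) => B * ∑ x ∈ D, spinAt x σ :=
  (Finset.measurable_sum _ fun x _ => measurable_spinAt x).const_mul B

/-- `|B Σ_{x∈D} σ_x| ≤ B·|D|` for `B ≥ 0`. [folklore] -/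
theorem abs_mul_sum_spinAt_le {B : ℝ} (hB : 0 ≤ B) (D : Finset (Site d)) (σ : SpinConfig (Site d)) :
    |B * ∑ x ∈ D, spinAt x σ| ≤ B * #D := by
  rw [abs_mul, abs_of_nonneg hB]
  refine mul_le_mul_of_nonneg_left ((Finset.abs_sum_le_sum_abs _ _).trans ?_) hB
  calc ∑ x ∈ D, |spinAt x σ| ≤ ∑ x ∈ D, (1 : ℝ) := Finset.sum_le_sum fun x _ => abs_spinAt_le_one x σ
    _ = #D := by simp

/-! ### Summable covariances: the local magnetisation and, by domination, every local observable -/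

section Cov

variable {μ : Measure (SpinConfig (Site d))} [IsProbabilityMeasure μ]

/-- **Covariances of the translated local magnetisations**:
`Cov(BΣ_{a∈D}σ_a, (BΣ_{b∈D}σ_b)∘θ_{−z}) = B² Σ_{a,b∈D} Cov(σ_0, σ_{b+z−a})` for a translation-invariant `μ`. [folklore] -/
theorem cov_sum_spinAt_shift_eq (hμ : IsTranslationInvariantMeasure μ) (B : ℝ) (D : Finset (Site d)) (z : Site d) :
    cov[fun σ => B * ∑ a ∈ D, spinAt a σ, fun σ => B * ∑ b ∈ D, spinAt b (configShift (-z) σ); μ] =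
      B ^ 2 * ∑ a ∈ D, ∑ b ∈ D, cov[spinAt 0, spinAt (b + z - a); μ] := by
  simp_rw [spinAt_configShift_neg]
  rw [covariance_const_mul_left, covariance_const_mul_right, ← mul_assoc, ← sq]
  congr 1
  rw [covariance_fun_sum_left' (fun a _ => memLp_spinAt μ a 2) (memLp_finsetSum _ fun b _ => memLp_spinAt μ (b + z) 2)]
  refine Finset.sum_congr rfl fun a _ => ?_
  rw [covariance_fun_sum_right' (fun b _ => memLp_spinAt μ (b + z) 2) (memLp_spinAt μ a 2)]
  refine Finset.sum_congr rfl fun b _ => ?_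
  rw [covariance_spinAt_eq_of_isTranslationInvariant hμ a (b + z)]

/-- **The local magnetisation has summable translated covariances** whenever `z ↦ Cov(σ_0, σ_z)` is summable (a finite
sum of translates of a summable function). [cite: Newman1980, Thm. 2 (D)] -/
theorem summable_cov_sum_spinAt_shift (hμ : IsTranslationInvariantMeasure μ)
    (hsum : Summable fun z : Site d => cov[spinAt 0, spinAt z; μ]) (B : ℝ) (D : Finset (Site d)) :
    Summable fun z : Site d =>
      cov[fun σ => B * ∑ a ∈ D, spinAt a σ, fun σ => B * ∑ b ∈ D, spinAt b (configShift (-z) σ); μ] := by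
  simp_rw [cov_sum_spinAt_shift_eq hμ B D]
  refine Summable.mul_left _ (summable_sum fun a _ => summable_sum fun b _ => ?_)
  have he : (fun z : Site d => cov[spinAt 0, spinAt (b + z - a); μ]) =
      (fun z : Site d => cov[spinAt 0, spinAt z; μ]) ∘ (Equiv.addRight (b - a)) := by
    funext z; simp only [Function.comp_apply, Equiv.coe_addRight]; congr 2; abel
  rw [he]
  exact hsum.comp_injective (Equiv.injective _)

/-- **Lipschitz domination of the covariances of a local observable** (Newman 1980, (12)): for a positively associated
`μ`, `f` depending on the spins in `D` with `|f| ≤ B`: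
`|Cov(f, f∘θ_{−z})| ≤ Cov(BΣ_{x∈D}σ_x, (BΣ_{x∈D}σ_x)∘θ_{−z})`. [cite: Newman1980, (12)] -/
theorem abs_cov_localObservable_shift_le (hPA : IsPositivelyAssociated μ) {f : SpinConfig (Site d) → ℝ}
    {D : Finset (Site d)} (hf : DependsOn f (↑D : Set (Site d))) (hfm : Measurable f) {B : ℝ} (hB : ∀ σ, |f σ| ≤ B)
    (z : Site d) :
    |cov[f, fun σ => f (configShift (-z) σ); μ]| ≤
      cov[fun σ => B * ∑ a ∈ D, spinAt a σ, fun σ => B * ∑ b ∈ D, spinAt b (configShift (-z) σ); μ] := by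
  have hB0 : 0 ≤ B := (abs_nonneg _).trans (hB 1)
  have hdom : ∀ ⦃σ σ' : SpinConfig (Site d)⦄, σ ≤ σ' →
      |f σ' - f σ| ≤ B * ∑ x ∈ D, spinAt x σ' - B * ∑ x ∈ D, spinAt x σ := abs_sub_le_of_dependsOn hf hB
  have hmono : Monotone (configShift (S := ℤˣ) (-z)) := configShift_monotone (-z)
  have hdomz : ∀ ⦃σ σ' : SpinConfig (Site d)⦄, σ ≤ σ' →
      |f (configShift (-z) σ') - f (configShift (-z) σ)| ≤
        B * ∑ x ∈ D, spinAt x (configShift (-z) σ') - B * ∑ x ∈ D, spinAt x (configShift (-z) σ) :=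
    fun σ σ' h => hdom (hmono h)
  have hid : ∀ a b : ℝ, |id a - id b| ≤ |a - b| := fun a b => le_rfl
  refine abs_covariance_le_covariance_of_dominated hPA hfm (hfm.comp (configShift (-z)).measurable)
    (measurable_mul_sum_spinAt B D) ((measurable_mul_sum_spinAt B D).comp (configShift (-z)).measurable)
    ⟨B, hB⟩ ⟨B, fun σ => hB _⟩ ⟨B * #D, abs_mul_sum_spinAt_le hB0 D⟩ ⟨B * #D, fun σ => abs_mul_sum_spinAt_le hB0 D _⟩
    ?_ ?_ ?_ ?_
  · exact monotone_add_comp_of_dominated hdom hid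
  · exact monotone_sub_comp_of_dominated hdom hid
  · exact monotone_add_comp_of_dominated hdomz hid
  · exact monotone_sub_comp_of_dominated hdomz hid

/-- **Every local observable has summable translated covariances** under a positively associated translation-invariant
measure with summable truncated two-point function (Newman's (D) transfers by domination).
[cite: Newman1980, (12) and Thm. 2 (D)] -/
theorem summable_cov_localObservable_shift (hPA : IsPositivelyAssociated μ) (hμ : IsTranslationInvariantMeasure μ)
    (hsum : Summable fun z : Site d => cov[spinAt 0, spinAt z; μ]) {f : SpinConfig (Site d) → ℝ}
    {D : Finset (Site d)} (hf : DependsOn f (↑D : Set (Site d))) :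
    Summable fun z : Site d => cov[f, fun σ => f (configShift (-z) σ); μ] := by
  classical
  have hfm : Measurable f := hf.measurable_of_finset D
  obtain ⟨B, hB⟩ := hf.exists_bound_of_finset D
  refine Summable.of_norm_bounded (summable_cov_sum_spinAt_shift hμ hsum B D) fun z => ?_
  rw [Real.norm_eq_abs]
  exact abs_cov_localObservable_shift_le hPA hf hfm hB z

/-- **The CLT variance of a local observable is nonnegative**: `0 ≤ Σ_z Cov(f, f∘θ_{−z})`, being the limit of
`Var(Σ_{z∈Λ_L} f∘θ_{−z})/|Λ_L| ≥ 0` (tree: `tendsto_sum_sum_box_div_card_of_summable`, `sum_sum_kernel_self_nonneg`).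
[cite: Newman1980, Thm. 2 (D); Ellis2006, Lemma V.7.1] -/
theorem tsum_cov_localObservable_shift_nonneg (hPA : IsPositivelyAssociated μ) (hμ : IsTranslationInvariantMeasure μ)
    (hsum : Summable fun z : Site d => cov[spinAt 0, spinAt z; μ]) {f : SpinConfig (Site d) → ℝ}
    {D : Finset (Site d)} (hf : DependsOn f (↑D : Set (Site d))) :
    0 ≤ ∑' z : Site d, cov[f, fun σ => f (configShift (-z) σ); μ] := by
  classical
  have hfm : Measurable f := hf.measurable_of_finset D
  obtain ⟨B, hB⟩ := hf.exists_bound_of_finset D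
  have hγ := summable_cov_localObservable_shift hPA hμ hsum hf
  have hXm : ∀ z : Site d, Measurable fun σ : SpinConfig (Site d) => f (configShift (-z) σ) := fun z =>
    hfm.comp (configShift (-z)).measurable
  have hcov : ∀ x y : Site d, cov[(fun (z : Site d) (σ : SpinConfig (Site d)) => f (configShift (-z) σ)) x,
      (fun (z : Site d) (σ : SpinConfig (Site d)) => f (configShift (-z) σ)) y; μ] =
      (fun z : Site d => cov[f, fun σ => f (configShift (-z) σ); μ]) (y - x) :=
    fun x y => covariance_comp_configShift_eq hμ f f x y
  refine ge_of_tendsto' (tendsto_sum_sum_box_div_card_of_summable _ hγ) fun L => ?_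
  have h0 := sum_sum_kernel_self_nonneg (γ := fun z : Site d => cov[f, fun σ => f (configShift (-z) σ); μ])
    hXm (fun z σ => hB _) hcov (box d L)
  exact div_nonneg h0 (Nat.cast_nonneg _)

end Cov

/-! ### THE CLT FOR LOCAL OBSERVABLES: generic, below `β_c`, and in the plus phase -/

/-- **NEWMAN'S CLT FOR LOCAL OBSERVABLES OF A SPIN SYSTEM, generic** (Newman 1980, Thm. 2 with the remark after (12);
Newman 1983): let `μ` be a positively associated, translation-invariant probability measure on `{−1,+1}^{ℤ^d}` (`d ≥ 1`)
with `Σ_z Cov_μ(σ_0, σ_z) < ∞`, and let `f` depend on the spins in a finite window `D`. Then with `X_z = f∘θ_{−z}`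
(the observable read at `z`) and `S_n = Σ_{z∈Λ_n} X_z`:

`(S_n − E_μ S_n)/√|Λ_n| → N(0, σ_f²)` in distribution, `σ_f² = Σ_{z∈ℤ^d} Cov_μ(f, f∘θ_{−z}) ∈ [0, ∞)`

(Mathlib `TendstoInDistribution`, for any `Y ~ gaussianReal 0 σ_f²`; `σ_f²` is summable and `≥ 0` by
`summable_cov_localObservable_shift`, `tsum_cov_localObservable_shift_nonneg`). [cite: Newman1980, Thm. 2 and remark after (12)] -/
theorem tendstoInDistribution_localObservable_of_summable {Ω' : Type*} {mΩ' : MeasurableSpace Ω'}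
    {P' : Measure Ω'} [IsProbabilityMeasure P'] {Y : Ω' → ℝ} {μ : Measure (SpinConfig (Site d))}
    [IsProbabilityMeasure μ] (hd : 1 ≤ d) (hPA : IsPositivelyAssociated μ) (hμ : IsTranslationInvariantMeasure μ)
    (hsum : Summable fun z : Site d => cov[spinAt 0, spinAt z; μ]) {f : SpinConfig (Site d) → ℝ}
    {D : Finset (Site d)} (hf : DependsOn f (↑D : Set (Site d))) {v : NNReal}
    (hv : (v : ℝ) = ∑' z : Site d, cov[f, fun σ => f (configShift (-z) σ); μ])
    (hY : HasLaw Y (gaussianReal 0 v) P') :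
    TendstoInDistribution (fun (n : ℕ) (σ : SpinConfig (Site d)) => (Real.sqrt #(box d n))⁻¹ *
        (∑ z ∈ box d n, f (configShift (-z) σ) - ∫ σ', ∑ z ∈ box d n, f (configShift (-z) σ') ∂μ))
      atTop Y (fun _ => μ) P' := by
  classical
  have hfm : Measurable f := hf.measurable_of_finset D
  obtain ⟨B, hB⟩ := hf.exists_bound_of_finset D
  have hB0 : 0 ≤ B := (abs_nonneg _).trans (hB 1)
  -- the field, its dominating field, and their covariance kernels (positional application of GD-C)
  have hXm : ∀ z : Site d, Measurable fun σ : SpinConfig (Site d) => f (configShift (-z) σ) := fun z =>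
    hfm.comp (configShift (-z)).measurable
  have hXdm : ∀ z : Site d, Measurable fun σ : SpinConfig (Site d) => B * ∑ a ∈ D, spinAt a (configShift (-z) σ) :=
    fun z => (measurable_mul_sum_spinAt B D).comp (configShift (-z)).measurable
  have hcov : ∀ x y : Site d, cov[(fun (z : Site d) (σ : SpinConfig (Site d)) => f (configShift (-z) σ)) x,
      (fun (z : Site d) (σ : SpinConfig (Site d)) => f (configShift (-z) σ)) y; μ] =
      (fun z : Site d => cov[f, fun σ => f (configShift (-z) σ); μ]) (y - x) :=
    fun x y => covariance_comp_configShift_eq hμ f f x y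
  have hcovd : ∀ x y : Site d,
      cov[(fun (z : Site d) (σ : SpinConfig (Site d)) => B * ∑ a ∈ D, spinAt a (configShift (-z) σ)) x,
        (fun (z : Site d) (σ : SpinConfig (Site d)) => B * ∑ a ∈ D, spinAt a (configShift (-z) σ)) y; μ] =
      (fun z : Site d => cov[fun σ => B * ∑ a ∈ D, spinAt a σ,
        fun σ => B * ∑ b ∈ D, spinAt b (configShift (-z) σ); μ]) (y - x) :=
    fun x y => covariance_comp_configShift_eq hμ (fun σ => B * ∑ a ∈ D, spinAt a σ)
      (fun σ => B * ∑ a ∈ D, spinAt a σ) x y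
  have hmono : ∀ z : Site d, Monotone (configShift (S := ℤˣ) (-z)) := fun z => configShift_monotone (-z)
  have hdom : ∀ z : Site d, ∀ ⦃σ σ' : SpinConfig (Site d)⦄, σ ≤ σ' →
      |(fun (z : Site d) (σ : SpinConfig (Site d)) => f (configShift (-z) σ)) z σ' -
          (fun (z : Site d) (σ : SpinConfig (Site d)) => f (configShift (-z) σ)) z σ| ≤
        (fun (z : Site d) (σ : SpinConfig (Site d)) => B * ∑ a ∈ D, spinAt a (configShift (-z) σ)) z σ' -
          (fun (z : Site d) (σ : SpinConfig (Site d)) => B * ∑ a ∈ D, spinAt a (configShift (-z) σ)) z σ :=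
    fun z σ σ' h => abs_sub_le_of_dependsOn hf hB (hmono z h)
  exact tendstoInDistribution_boxSum_of_dominated hd hPA hXm hB0
    (fun z σ => hB _) hcov (summable_cov_localObservable_shift hPA hμ hsum hf) hXdm
    (fun z σ => abs_mul_sum_spinAt_le hB0 D _) hcovd (summable_cov_sum_spinAt_shift hμ hsum B D) hdom hv hY

/-- **CLT FOR EVERY LOCAL OBSERVABLE OF THE ISING MODEL BELOW `β_c`** (Newman 1980 / 1983 with sharpness; UNCONDITIONAL):
for `d ≥ 2`, `0 ≤ β < β_c(d)`, the free state `μ` at zero field (`∫ σ_A dμ = ⟨σ_A⟩^∅_{β,0}`) and any `f` depending on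
finitely many spins: `|Λ_n|^{-1/2} Σ_{z∈Λ_n} (f∘θ_{−z} − E^∅_β f) ⇒ N(0, Σ_z Cov^∅_β(f, f∘θ_{−z}))`.
[cite: Newman1980, Thm. 2 and remark after (12); Ellis2006, Thm. V.7.2; AizenmanBarskyFernandezJSP1987, Thm. 1] -/
theorem tendstoInDistribution_localObservable_free_of_lt_criticalBeta {Ω' : Type*} {mΩ' : MeasurableSpace Ω'}
    {P' : Measure Ω'} [IsProbabilityMeasure P'] {Y : Ω' → ℝ} (hd : 2 ≤ d) {β : ℝ} (hβ : 0 ≤ β)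
    (hβc : β < criticalBeta d) (μ : Measure (SpinConfig (Site d))) [IsProbabilityMeasure μ]
    (hμ : ∀ A : Finset (Site d), spinCorr μ A = freeCorr d β 0 A) {f : SpinConfig (Site d) → ℝ}
    {D : Finset (Site d)} (hf : DependsOn f (↑D : Set (Site d))) {v : NNReal}
    (hv : (v : ℝ) = ∑' z : Site d, cov[f, fun σ => f (configShift (-z) σ); μ])
    (hY : HasLaw Y (gaussianReal 0 v) P') :
    TendstoInDistribution (fun (n : ℕ) (σ : SpinConfig (Site d)) => (Real.sqrt #(box d n))⁻¹ *
        (∑ z ∈ box d n, f (configShift (-z) σ) - #(box d n) * ∫ σ', f σ' ∂μ)) atTop Y (fun _ => μ) P' := by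
  classical
  have hT := isTranslationInvariantMeasure_of_spinCorr_eq_freeCorr hβ le_rfl μ hμ
  have hsum : Summable fun z : Site d => cov[spinAt 0, spinAt z; μ] := by
    simp_rw [covariance_spinAt_eq_twoPointFree hβ hμ, sub_zero]
    exact summable_twoPointFree_of_lt_criticalBeta hd hβ hβc
  have key := tendstoInDistribution_localObservable_of_summable (le_trans one_le_two hd)
    (isPositivelyAssociated_of_spinCorr_eq_freeCorr hβ le_rfl μ hμ) hT hsum hf hv hY
  have hfm : Measurable f := hf.measurable_of_finset D
  obtain ⟨B, hB⟩ := hf.exists_bound_of_finset D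
  have hmean : ∀ n : ℕ, ∫ σ', ∑ z ∈ box d n, f (configShift (-z) σ') ∂μ = #(box d n) * ∫ σ', f σ' ∂μ := by
    intro n
    have hXm : ∀ z : Site d, Measurable fun σ : SpinConfig (Site d) => f (configShift (-z) σ) := fun z =>
      hfm.comp (configShift (-z)).measurable
    rw [integral_finsetSum _ fun z _ => integrable_of_abs_le (hXm z) (fun σ => hB _)]
    have hz : ∀ z : Site d, ∫ σ', f (configShift (-z) σ') ∂μ = ∫ σ', f σ' ∂μ := fun z => by
      conv_rhs => rw [← hT (-z)]
      rw [integral_map_equiv]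
    simp only [hz, Finset.sum_const, nsmul_eq_mul]
  simp only [hmean] at key
  exact key

end IsingCLT

end Summit.CriticalPhenomena.PercolationContinuityZ3.Theorems.FK

end
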